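import Literature.NumberTheory.LFunctions.ZetaArgSIntegralLowHeight
import Literature.NumberTheory.LFunctions.RiemannSiegelThetaSmallHeight
import Literature.Analysis.ValidatedNumerics.IntervalLogArctan
import Literature.Analysis.SpecialFunctions.LogPiBounds
import HarnessLib

/-!
# RH-FREE — Brent–Platt–Trudgian's standing condition (2.9) on `[2π, 168π]` by a kernel-checked interval computation over the certified zeros: DISCHARGE of `BrentPlattTrudgian2021_eq29`; `S₁(168π) ∈ [−0.98663, −0.9866]` and Simonič's unconditional `|S₁(t)| ≤ 0.059 log t + 3.054` (`t ≥ 1`) («nothing here bears on the truth of RH»)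

Topic `Literature/NumberTheory/LFunctions` (RH literature-typing tranche 1, L4 "explicit zero
statistics", gen 8; computational lane: one `native_decide` evaluation declared to the gate, on top of
the tree's certified first `2000` zeros `SchoenfeldZerosLow.lean` and Trudgian's numerics, themselves
`native_decide` certificates). Label: **RH-FREE**. THEOREMS plus the computable test functions they
evaluate; NO named fact (D-0026). Nothing here bears on the truth of RH.

Brent–Platt–Trudgian, Math. Comp. 90 (2021), §2, eq. (2.9) and the sentence after it: "From
[Trudgian 2011], `|S₁(T) − c₀| ≤ A₀ + A₁ log T` (2.9) for all `T ≥ 168π`, where `c₀ = S₁(168π)`,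
`A₀ = 2.067`, `A₁ = 0.059`. However, a small computation shows that (2.9) also holds for
`T ∈ [2π, 168π]`." This is the named fact `Literature.NumberTheory.LFunctions.BrentPlattTrudgian2021_eq29`
(`ZetaZeroSumsLehmanExplicit.lean`): `∀ T ≥ 2π, |∫_{168π}^T S(t) dt| ≤ 2.067 + 0.059 log T`. Here the
"small computation" is carried out IN THE KERNEL'S ARITHMETIC (scale `2⁶⁴`, the tree's verified
interval engine `Literature.Analysis.ValidatedNumerics.NumericsMP.MI` with its `logPos`):

* the interval `[2π, 168π]` is covered by `2087` cells `[2π, 6.5]`, `[k/4, (k+1)/4]` (`26 ≤ k ≤ 2110`),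
  `[527.75, 168π]`; on a cell `[a, b]` the analytic reduction
  `Literature.NumberTheory.LFunctions.abs_integral_zetaArgS_le_of_cell` (`ZetaArgSIntegralLowHeight.lean`)
  asks for: enclosures of `π∫_b^{168π} S = π Σ_{j<2000} max(0, 168π − max(γ_j, b)) − (Θ(168π) − Θ(b))
  − π(168π − b) ± 0.007` (`Literature.NumberTheory.LFunctions.abs_pi_mul_integral_zetaArgS_sub_closedForm_le`;
  the `γ_j` from the certified brackets `[a_j, a_j+1]·2⁻²⁴⁰`, hence `[⌊a_j/2¹⁷⁶⌋, ⌊a_j/2¹⁷⁶⌋+2]·2⁻⁶⁴`),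
  of `θ₀(a) = (a/2)log(a/2π) − a/2 − π/8`, of `π(2.067 + 0.059 log a)`, and the counts
  `N⁻ = #{j : (⌊a_j/2¹⁷⁶⌋+2) ≤ 2⁶⁴a} ≤ N(a)`, `N(b) ≤ N⁺ = #{j : ⌊a_j/2¹⁷⁶⌋ ≤ 2⁶⁴b}`; the test is
  `J⁺ + ¼ max(0, πN⁺ − θ⁻ − π) ≤ C⁻` and `−J⁻ + ¼ max(0, θ⁺ + π − πN⁻) ≤ C⁻`
  (`S1LowNumerics.cellOk`); all `2087` cells pass (`S1LowNumerics.checkAll_eq_true`, `native_decide`),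
  with margins `≥ 1.5` in a bound `≥ 2.17` (`∫_T^{168π} S` ranges over `[−0.84, 0.51]`);
* `abs_integral_zetaArgS_from_168pi_le_of_le_168pi` — **for `2π ≤ T ≤ 168π`,
  `|∫_{168π}^T S(t) dt| ≤ 2.067 + 0.059 log T`**;
* `BrentPlattTrudgian2021_eq29_holds : BrentPlattTrudgian2021_eq29` — the DISCHARGE (the range
  `T > 168π` is Trudgian 2011, Thm 2.2, the tree's theorem, via
  `Literature.NumberTheory.LFunctions.abs_integral_zetaArgS_from_168pi_le_of_le`).

* (appended) **`S₁` at small height and Simonič's (1.7).** Simonič, J. Number Theory 231 (2022),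
  eq. (1.7): "`|S₁(t)| ≤ 0.059 log t + 3.054` for `t ≥ 1`", with the footnote "This follows from
  [Trudgian], and the fact that `|S₁(168π)| ≤ 0.987` and (1.7) is true for `1 ≤ t ≤ 168π`." Both
  numerical inputs are certified here: `πS₁(T)` for `T ≤ 14` is the closed form of
  `Literature.NumberTheory.LFunctions.abs_pi_mul_integral_zetaArgS_small_le`
  (`RiemannSiegelThetaSmallHeight.lean`: shifted Stirling series of `log Γ`, error `3.6·10⁻⁸T²/4`),
  evaluated in complex box arithmetic (`MC`, `logUpper`) at `T = k/8`, `8 ≤ k ≤ 50`, and at `T = 2π`;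
  `π∫_{2π}^{168π} S` is the sharp closed form
  `Literature.NumberTheory.LFunctions.abs_pi_mul_integral_zetaArgS_sub_closedForm_le_sharp` (error
  `1.6·10⁻⁵`). Results (`S1LowNumerics.s1Checks_eq_true`, `native_decide`, a few seconds):
  `zetaArgS1_168pi_bounds` — **`S₁(168π) ∈ [−0.98663, −0.9866]`**; `abs_zetaArgS1_168pi_le` —
  `|S₁(168π)| ≤ 0.987`; `abs_zetaArgS1_le_of_le_two_pi` — `|S₁(t)| ≤ 3.054` on `[1, 2π]` (grid step
  `1/8`, `|πS| ≤ π + 2.7·6.375` below the first zero); `abs_zetaArgS1_le` — **Simonič's (1.7),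
  `|S₁(t)| ≤ 0.059 log t + 3.054` for all `t ≥ 1`** (for `t ≥ 2π`: `0.987 + (2.9)`). This is the
  unconditional input by which `Simonic2022_cor1_S1_v2` reduces to `Simonic2022_thm1_S1`
  (`ZetaArgRHExplicit.lean`, module docstring).

## References

* A. Simonič, *On explicit estimates for S(t), S₁(t), and ζ(1/2+it) under the Riemann Hypothesis*,
  J. Number Theory 231 (2022) 464–491, eq. (1.7) and its footnote. [Simonic2022]
* R. P. Brent, D. J. Platt, T. S. Trudgian, *The mean square of the error term in the prime number
  theorem*, Math. Comp. 90 (2021) 2923–2935 (arXiv:2008.06140), §2 eq. (2.9). [BrentPlattTrudgian2021]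
* T. S. Trudgian, *Improvements to Turing's method*, Math. Comp. 80 (2011) 2259–2279, Thm 2.2. [Trudgian2011]
* A. M. Odlyzko, H. J. J. te Riele, J. reine angew. Math. 357 (1985), §4.2 (the first `2000` zeros;
  the tree's certificate). [OdlyzkoTeRiele1985]
-/

noncomputable section

open Complex Real Set Filter MeasureTheory intervalIntegral

namespace Literature.NumberTheory.LFunctions

open SchoenfeldBound ZetaNumerics.Mertens Literature.Analysis.ValidatedNumerics.NumericsMP
  Literature.Analysis.ValidatedNumerics

namespace S1LowNumerics

/-! ## The certificate (computable) -/

/-- The working scale `2⁶⁴` (a literal). [folklore] -/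
def SC : ℕ := 18446744073709551616

/-- Number of series terms for the kernel logarithms. [folklore] -/
def KLOG : ℕ := 60

/-- Number of cells. [folklore] -/
def NCELL : ℕ := 2087

/-- `π ∈ [lo, hi]·2⁻⁶⁴` from Mathlib's `20`-digit enclosure. [folklore] -/
def piI : MI := ⟨57952155664616982739, 57952155664616982740⟩

/-- `log 2π = log 2 + log π ∈ [lo, hi]·2⁻⁶⁴` from the tree's `20`-digit enclosures. [folklore] -/
def log2PiI : MI := ⟨12786308645202655659 + 21116539237790634173, 12786308645202655661 + 21116539237790634174⟩

/-- `168π`. [folklore] -/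
def uI : MI := piI.mulInt 168

/-- `2π`. [folklore] -/
def twoPiI : MI := piI.mulInt 2

/-- Left endpoint of cell `i`: `2π` for `i = 0`, else `(25 + i)/4`. [folklore] -/
def aI (i : ℕ) : MI := if i = 0 then twoPiI else MI.ofFrac SC ((25 + i : ℕ) : ℤ) 4

/-- Right endpoint of cell `i`: `168π` for the last cell, else `(26 + i)/4`. [folklore] -/
def bI (i : ℕ) : MI := if i + 1 = NCELL then uI else MI.ofFrac SC ((26 + i : ℕ) : ℤ) 4

/-- Scaled lower end of the `j`-th zero bracket: `⌊a_j/2¹⁷⁶⌋ ≤ 2⁶⁴ γ_j`. [folklore] -/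
def gLo (j : ℕ) : ℤ := ordinate j / 2 ^ 176

/-- Scaled upper end of the `j`-th zero bracket: `2⁶⁴ γ_j ≤ ⌊a_j/2¹⁷⁶⌋ + 2`. [folklore] -/
def gHi (j : ℕ) : ℤ := ordinate j / 2 ^ 176 + 2

/-- Lower bound for `2⁶⁴ Σ_{j<2000} max(0, 168π − max(γ_j, b))`. [folklore] -/
def sumLo (B : MI) : ℤ := ∑ j ∈ Finset.range 2000, max 0 (uI.lo - max (gHi j) B.hi)

/-- Upper bound for `2⁶⁴ Σ_{j<2000} max(0, 168π − max(γ_j, b))`. [folklore] -/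
def sumHi (B : MI) : ℤ := ∑ j ∈ Finset.range 2000, max 0 (uI.hi - max (gLo j) B.lo)

/-- `N⁻ ≤ N(a)`: zeros whose bracket lies entirely below `a`. [folklore] -/
def nLo (A : MI) : ℕ := ((Finset.range 2000).filter fun j ↦ gHi j ≤ A.lo).card

/-- `N(b) ≤ N⁺`: zeros whose bracket starts below `b`. [folklore] -/
def nHi (B : MI) : ℕ := ((Finset.range 2000).filter fun j ↦ gLo j ≤ B.hi).card

/-- Enclosure of `Θ(x) = (x²/4)(log x − log 2π) − 3x²/8 − πx/8 + (log x)/48` from `X ∋ x`, `LX ∋ log x`.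
[folklore] -/
def thetaInt (X LX : MI) : MI :=
  (((MI.mul SC ((MI.mul SC X X).divNat 4) (LX.sub log2PiI)).sub (((MI.mul SC X X).mulInt 3).divNat 8)).sub
    ((MI.mul SC piI X).divNat 8)).add (LX.divNat 48)

/-- Enclosure of `θ₀(a) = (a/2)(log a − log 2π) − a/2 − π/8` from `A ∋ a`, `LA ∋ log a`. [folklore] -/
def theta0 (A LA : MI) : MI :=
  (((MI.mul SC A (LA.sub log2PiI)).divNat 2).sub (A.divNat 2)).sub (piI.divNat 8)

/-- `⌈0.007 · 2⁶⁴⌉` (closed-form error of `π∫_b^{168π} S`). [folklore] -/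
def WJ : ℤ := 129127208515966862

/-- `⌈0.687512 · 2⁶⁴⌉` (`θ ≥ θ₀(a) − 1.2·10⁻⁵ − 2.75/4` on a cell). [folklore] -/
def RLO : ℤ := 12682357911604201251

/-- `⌈0.690842 · 2⁶⁴⌉` (`θ ≤ θ₀(a) + 0.00333 + 1.2·10⁻⁵ + 2.75/4` on a cell). [folklore] -/
def RHI : ℤ := 12743785569369654058

/-- Enclosure of `J(b) = π∫_b^{168π} S` on cell `i` from `LU ∋ log 168π`, `LB ∋ log b`. [folklore] -/
def jbI (i : ℕ) (LU LB : MI) : MI :=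
  (((MI.mul SC piI ⟨sumLo (bI i), sumHi (bI i)⟩).sub ((thetaInt uI LU).sub (thetaInt (bI i) LB))).sub
    (MI.mul SC piI (uI.sub (bI i)))).widen WJ

/-- Enclosure of `πN⁺ − θ⁻ − π` on cell `i` (`θ⁻ = θ₀⁻(a) − 0.687512`). [folklore] -/
def xI (i : ℕ) (LA : MI) : MI :=
  ((piI.mulInt (nHi (bI i))).sub (MI.ofScaled ((theta0 (aI i) LA).lo - RLO))).sub piI

/-- Enclosure of `θ⁺ + π − πN⁻` on cell `i` (`θ⁺ = θ₀⁺(a) + 0.690842`). [folklore] -/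
def yI (i : ℕ) (LA : MI) : MI :=
  ((MI.ofScaled ((theta0 (aI i) LA).hi + RHI)).add piI).sub (piI.mulInt (nLo (aI i)))

/-- Enclosure of `π(2.067 + 0.059 log a)` from `LA ∋ log a`. [folklore] -/
def cI (LA : MI) : MI :=
  MI.mul SC piI ((MI.ofFrac SC 2067 1000).add ((LA.mulInt 59).divNat 1000))

/-- The test on cell `i`: `4J⁺ + max(0, X⁺) ≤ 4C⁻` and `−4J⁻ + max(0, Y⁺) ≤ 4C⁻`. [folklore] -/
def cellOk (i : ℕ) : Bool :=
  match MI.logPos SC KLOG uI, MI.logPos SC KLOG (aI i), MI.logPos SC KLOG (bI i) with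
  | some LU, some LA, some LB =>
    decide ((jbI i LU LB).hi * 4 + max 0 (xI i LA).hi ≤ (cI LA).lo * 4) &&
      decide (-(jbI i LU LB).lo * 4 + max 0 (yI i LA).hi ≤ (cI LA).lo * 4)
  | _, _, _ => false

/-- All cells pass. [folklore] -/
def checkAll : Bool := (List.range NCELL).all cellOk

/-- **The compiled evaluation**: all `2087` cell tests pass. Declared to the gate as `computational`
(`native_decide`). [cite: BrentPlattTrudgian2021, §2 eq. (2.9) ("a small computation shows")] -/
theorem checkAll_eq_true : checkAll = true := by
  native_decide

/-! ## Soundness of the data -/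

/-- `0 < 2⁶⁴`. [folklore] -/
private theorem SC_pos : 0 < SC := by norm_num [SC]

/-- `π ∈ piI`. [folklore] -/
private theorem mem_piI : MI.mem SC π piI := by
  have h1 := Real.pi_gt_d20
  have h2 := Real.pi_lt_d20
  simp only [MI.mem, piI, SC]
  push_cast
  constructor <;> nlinarith

/-- `log 2π ∈ log2PiI`. [folklore] -/
private theorem mem_log2PiI : MI.mem SC (Real.log (2 * π)) log2PiI := by
  have h1 := Literature.Analysis.SpecialFunctions.Real.log_two_gt_d20
  have h2 := Literature.Analysis.SpecialFunctions.Real.log_two_lt_d20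
  have h3 := Literature.Analysis.SpecialFunctions.Real.log_pi_gt_d20
  have h4 := Literature.Analysis.SpecialFunctions.Real.log_pi_lt_d20
  rw [Real.log_mul (by norm_num) Real.pi_ne_zero]
  simp only [MI.mem, log2PiI, SC]
  push_cast
  constructor <;> nlinarith

/-- `168π ∈ uI`. [folklore] -/
private theorem mem_uI : MI.mem SC (168 * π) uI := by
  have h := MI.mem_mulInt mem_piI 168
  rw [show (168 : ℝ) * π = π * ((168 : ℤ) : ℝ) by push_cast; ring]
  exact h

/-- `2π ∈ twoPiI`. [folklore] -/
private theorem mem_twoPiI : MI.mem SC (2 * π) twoPiI := by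
  have h := MI.mem_mulInt mem_piI 2
  rw [show (2 : ℝ) * π = π * ((2 : ℤ) : ℝ) by push_cast; ring]
  exact h

/-- The real left endpoint of cell `i`. [folklore] -/
private def aR (i : ℕ) : ℝ := if i = 0 then 2 * π else ((25 + i : ℕ) : ℝ) / 4

/-- The real right endpoint of cell `i`. [folklore] -/
private def bR (i : ℕ) : ℝ := if i + 1 = NCELL then 168 * π else ((26 + i : ℕ) : ℝ) / 4

/-- `aR i ∈ aI i`. [folklore] -/
private theorem mem_aI (i : ℕ) : MI.mem SC (aR i) (aI i) := by
  unfold aR aI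
  split_ifs with h
  · exact mem_twoPiI
  · have := MI.mem_ofFrac SC ((25 + i : ℕ) : ℤ) (q := 4) (by norm_num)
    simpa using this

/-- `bR i ∈ bI i`. [folklore] -/
private theorem mem_bI (i : ℕ) : MI.mem SC (bR i) (bI i) := by
  unfold bR bI
  split_ifs with h
  · exact mem_uI
  · have := MI.mem_ofFrac SC ((26 + i : ℕ) : ℤ) (q := 4) (by norm_num)
    simpa using this

/-- The cells: `2π ≤ aR i`, `bR i ≤ 168π`, `bR i − aR i ≤ 1/4` (`i < 2087`). [folklore] -/
private theorem cell_geometry {i : ℕ} (hi : i < NCELL) :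
    2 * π ≤ aR i ∧ bR i ≤ 168 * π ∧ bR i - aR i ≤ 1 / 4 := by
  have hπ1 : 3.14159 < π := by linarith [Real.pi_gt_d6]
  have hπ2 : π < 3.1416 := by linarith [Real.pi_lt_d4]
  unfold NCELL at hi
  rcases Nat.eq_zero_or_pos i with h0 | h0
  · subst h0
    simp only [aR, bR, NCELL, if_true, show (0 + 1 ≠ 2087) by norm_num, if_false]
    norm_num
    constructor <;> nlinarith
  have ha : aR i = ((25 + i : ℕ) : ℝ) / 4 := by simp [aR, h0.ne']
  rw [ha]
  by_cases hlast : i + 1 = NCELL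
  · have hb : bR i = 168 * π := by simp [bR, hlast]
    have hi' : i = 2086 := by unfold NCELL at hlast; omega
    subst hi'
    rw [hb]
    norm_num
    constructor <;> nlinarith
  · have hb : bR i = ((26 + i : ℕ) : ℝ) / 4 := by simp [bR, hlast]
    rw [hb]
    have h1 : (26 : ℝ) ≤ ((25 + i : ℕ) : ℝ) := by exact_mod_cast (by omega : 26 ≤ 25 + i)
    have h2 : ((26 + i : ℕ) : ℝ) ≤ 2111 := by
      unfold NCELL at hlast; exact_mod_cast (by omega : 26 + i ≤ 2111)
    have h3 : ((26 + i : ℕ) : ℝ) = ((25 + i : ℕ) : ℝ) + 1 := by push_cast; ring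
    refine ⟨by nlinarith, by nlinarith, by rw [h3]; linarith⟩

/-- The scaled brackets: `gLo j ≤ 2⁶⁴ γ_j ≤ gHi j` (`j < 2000`; the data and the large powers are kept
unevaluated). [cite: OdlyzkoTeRiele1985, §4.2 p. 151] -/
private theorem gLo_le_gHi {j : ℕ} (hj : j < 2000) :
    (gLo j : ℝ) ≤ lowOrdinate j * SC ∧ lowOrdinate j * SC ≤ (gHi j : ℝ) := by
  obtain ⟨⟨h1, h2⟩, -⟩ := lowOrdinate_spec hj
  unfold t₁ at h1
  unfold t₂ at h2
  unfold gLo gHi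
  have hDpos : (0 : ℤ) < 2 ^ 176 := by positivity
  have hq1 := Numerics.fdiv_mul_le_real (a := ordinate j) hDpos
  have hq2 : ((ordinate j : ℤ) : ℝ) < (((ordinate j / 2 ^ 176 : ℤ) : ℝ) + 1) * ((2 ^ 176 : ℤ) : ℝ) := by
    have h := Int.lt_ediv_add_one_mul_self (ordinate j) hDpos
    have h' : ((ordinate j : ℤ) : ℝ) < (((ordinate j / 2 ^ 176 + 1) * 2 ^ 176 : ℤ) : ℝ) := Int.cast_lt.2 h
    rwa [Int.cast_mul, Int.cast_add, Int.cast_one] at h'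
  generalize (ordinate j / 2 ^ 176 : ℤ) = q at hq1 hq2 ⊢
  have eD : ((2 ^ 176 : ℤ) : ℝ) = (2 : ℝ) ^ 176 := by rw [Int.cast_pow, Int.cast_ofNat]
  rw [eD] at hq1 hq2
  simp only [Int.cast_add, Int.cast_ofNat]
  have eS : (SC : ℝ) = (2 : ℝ) ^ 64 := by norm_num [SC]
  have e240 : (2 : ℝ) ^ 240 = 2 ^ 176 * 2 ^ 64 := by rw [← pow_add]
  rw [eS]
  rw [e240] at h1 h2
  generalize (ordinate j : ℝ) = o at h1 h2 hq1 hq2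
  have hP0 : (0 : ℝ) < 2 ^ 176 := by positivity
  have hQ0 : (0 : ℝ) < 2 ^ 64 := by positivity
  have hP1 : (1 : ℝ) ≤ 2 ^ 176 := one_le_pow₀ (by norm_num)
  generalize (2 : ℝ) ^ 176 = P at *
  generalize (2 : ℝ) ^ 64 = Q at *
  rw [div_le_iff₀ (by positivity)] at h1
  rw [le_div_iff₀ (by positivity)] at h2
  constructor
  · have : (q : ℝ) * P ≤ lowOrdinate j * Q * P := by nlinarith
    exact le_of_mul_le_mul_right this hP0
  · have : lowOrdinate j * Q * P ≤ ((q : ℝ) + 2) * P := by nlinarith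
    exact le_of_mul_le_mul_right this hP0

/-- One term of the zero sum: `max(0, uI.lo − max(gHi j, B.hi)) ≤ 2⁶⁴ max(0, 168π − max(γ_j, b))
≤ max(0, uI.hi − max(gLo j, B.lo))` (`b ∈ B`, `j < 2000`). [folklore] -/
private theorem term_bounds {b : ℝ} {B : MI} (hb : MI.mem SC b B) {j : ℕ} (hj : j < 2000) :
    ((max 0 (uI.lo - max (gHi j) B.hi) : ℤ) : ℝ) ≤ max 0 (168 * π - max (lowOrdinate j) b) * SC ∧
      max 0 (168 * π - max (lowOrdinate j) b) * SC ≤ ((max 0 (uI.hi - max (gLo j) B.lo) : ℤ) : ℝ) := by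
  have hS : (0 : ℝ) < SC := by exact_mod_cast SC_pos
  obtain ⟨hg1, hg2⟩ := gLo_le_gHi hj
  obtain ⟨hu1, hu2⟩ := mem_uI
  obtain ⟨hb1, hb2⟩ := hb
  have emax : max 0 (168 * π - max (lowOrdinate j) b) * SC =
      max 0 ((168 * π) * SC - max (lowOrdinate j * SC) (b * SC)) := by
    rw [max_mul_of_nonneg _ _ hS.le, zero_mul, sub_mul, max_mul_of_nonneg _ _ hS.le]
  rw [emax]
  push_cast
  constructor
  · refine max_le_max le_rfl (sub_le_sub hu1 (max_le_max hg2 hb2))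
  · exact max_le_max le_rfl (sub_le_sub hu2 (max_le_max hg1 hb1))

/-- The zero sum: `Σ_{j<2000} max(0, 168π − max(γ_j, b)) ∈ ⟨sumLo B, sumHi B⟩` for `b ∈ B`.
[cite: OdlyzkoTeRiele1985, §4.2 p. 151] -/
private theorem mem_sum {b : ℝ} {B : MI} (hb : MI.mem SC b B) :
    MI.mem SC (∑ j ∈ Finset.range 2000, max 0 (168 * π - max (lowOrdinate j) b)) ⟨sumLo B, sumHi B⟩ := by
  simp only [MI.mem, sumLo, sumHi]
  rw [Finset.sum_mul]
  push_cast
  constructor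
  · exact Finset.sum_le_sum fun j hj ↦ by
      have := (term_bounds hb (Finset.mem_range.1 hj)).1
      push_cast at this
      exact this
  · exact Finset.sum_le_sum fun j hj ↦ by
      have := (term_bounds hb (Finset.mem_range.1 hj)).2
      push_cast at this
      exact this

/-- `N(t) = #{j < 2000 : γ_j ≤ t}` for `0 ≤ t ≤ 2516`. [cite: OdlyzkoTeRiele1985, §4.2 p. 151] -/
private theorem zetaZeroCount_eq_card {t : ℝ} (h0 : 0 ≤ t) (ht : t ≤ heightT0) :
    zetaZeroCount t = ((Finset.range 2000).filter fun j ↦ lowOrdinate j ≤ t).card := by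
  have h := zetaZeroCount_eq_sum_ite_lowOrdinate h0 ht
  rw [Finset.sum_boole] at h
  exact_mod_cast h

/-- The counts: `nLo A ≤ N(a)` and `N(b) ≤ nHi B` for `a ∈ A`, `b ∈ B` in `[0, 2516]`.
[cite: OdlyzkoTeRiele1985, §4.2 p. 151] -/
private theorem count_bounds {a : ℝ} {A : MI} (ha : MI.mem SC a A) (ha0 : 0 ≤ a) (haT : a ≤ heightT0) :
    nLo A ≤ zetaZeroCount a ∧ zetaZeroCount a ≤ nHi A := by
  have hS : (0 : ℝ) < SC := by exact_mod_cast SC_pos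
  rw [zetaZeroCount_eq_card ha0 haT]
  unfold nLo nHi
  constructor
  · refine Finset.card_le_card fun j hj ↦ ?_
    rw [Finset.mem_filter] at hj ⊢
    refine ⟨hj.1, ?_⟩
    have hg := (gLo_le_gHi (Finset.mem_range.1 hj.1)).2
    have h1 : (gHi j : ℝ) ≤ (A.lo : ℝ) := by exact_mod_cast hj.2
    have h2 := ha.1
    exact le_of_mul_le_mul_right (by linarith) hS
  · refine Finset.card_le_card fun j hj ↦ ?_
    rw [Finset.mem_filter] at hj ⊢
    refine ⟨hj.1, ?_⟩
    have hg := (gLo_le_gHi (Finset.mem_range.1 hj.1)).1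
    have h2 := mul_le_mul_of_nonneg_right hj.2 hS.le
    have h1 : (gLo j : ℝ) ≤ (A.hi : ℝ) := by linarith [ha.2]
    exact_mod_cast h1

/-- `Θ(x) ∈ thetaInt X LX` for `x ∈ X`, `log x ∈ LX`. [folklore] -/
private theorem mem_thetaInt {x : ℝ} {X LX : MI} (hx : MI.mem SC x X) (hl : MI.mem SC (Real.log x) LX) :
    MI.mem SC (x ^ 2 / 4 * (Real.log x - Real.log (2 * π)) - 3 * x ^ 2 / 8 - π * x / 8 + Real.log x / 48)
      (thetaInt X LX) := by
  have hS := SC_pos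
  have hx2 := MI.mem_mul hS hx hx
  have h1 := MI.mem_mul hS (MI.mem_divNat hx2 (n := 4) (by norm_num)) (MI.mem_sub hl mem_log2PiI)
  have h2 := MI.mem_divNat (MI.mem_mulInt hx2 3) (n := 8) (by norm_num)
  have h3 := MI.mem_divNat (MI.mem_mul hS mem_piI hx) (n := 8) (by norm_num)
  have h4 := MI.mem_divNat hl (n := 48) (by norm_num)
  have h := MI.mem_add (MI.mem_sub (MI.mem_sub h1 h2) h3) h4
  unfold thetaInt
  convert h using 1
  push_cast
  ring

/-- `θ₀(a) ∈ theta0 A LA` for `a ∈ A`, `log a ∈ LA`. [folklore] -/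
private theorem mem_theta0 {a : ℝ} {A LA : MI} (ha : MI.mem SC a A) (hl : MI.mem SC (Real.log a) LA) :
    MI.mem SC (a / 2 * (Real.log a - Real.log (2 * π)) - a / 2 - π / 8) (theta0 A LA) := by
  have hS := SC_pos
  have h1 := MI.mem_divNat (MI.mem_mul hS ha (MI.mem_sub hl mem_log2PiI)) (n := 2) (by norm_num)
  have h2 := MI.mem_divNat ha (n := 2) (by norm_num)
  have h3 := MI.mem_divNat mem_piI (n := 8) (by norm_num)
  have h := MI.mem_sub (MI.mem_sub h1 h2) h3
  unfold theta0
  convert h using 1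
  push_cast
  ring

/-! ## Soundness of one cell -/

/-- `π∫_b^{168π} S ∈ jbI i LU LB` (`b = bR i ≥ 2π`, `LU ∋ log 168π`, `LB ∋ log b`).
[cite: BrentPlattTrudgian2021, §2 eq. (2.9)] -/
private theorem mem_jbI {i : ℕ} {LU LB : MI} (hLU : MI.mem SC (Real.log (168 * π)) LU)
    (hLB : MI.mem SC (Real.log (bR i)) LB) (hb : 2 * π ≤ bR i) (hbU : bR i ≤ 168 * π) :
    MI.mem SC (π * ∫ t in (bR i)..(168 * π), zetaArgS t) (jbI i LU LB) := by
  have hS := SC_pos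
  have hSr : (0 : ℝ) < SC := by exact_mod_cast SC_pos
  have hcore := MI.mem_sub (MI.mem_sub (MI.mem_mul hS mem_piI (mem_sum (mem_bI i)))
    (MI.mem_sub (mem_thetaInt mem_uI hLU) (mem_thetaInt (mem_bI i) hLB)))
    (MI.mem_mul hS mem_piI (MI.mem_sub mem_uI (mem_bI i)))
  have hclosed := abs_pi_mul_integral_zetaArgS_sub_closedForm_le hb hbU
  unfold jbI
  exact MI.mem_widen hcore (le_trans (mul_le_mul_of_nonneg_right hclosed hSr.le) (by norm_num [WJ, SC]))

/-- `πN⁺ − (θ₀⁻ − RLO)/2⁶⁴ − π ∈ xI i LA`. [folklore] -/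
private theorem mem_xI (i : ℕ) (LA : MI) :
    MI.mem SC (π * (nHi (bI i) : ℝ) - (((theta0 (aI i) LA).lo - RLO : ℤ) : ℝ) / SC - π) (xI i LA) := by
  have h := MI.mem_sub (MI.mem_sub (MI.mem_mulInt mem_piI (nHi (bI i)))
    (MI.mem_ofScaled SC_pos ((theta0 (aI i) LA).lo - RLO))) mem_piI
  unfold xI
  convert h using 2
  push_cast
  ring

/-- `(θ₀⁺ + RHI)/2⁶⁴ + π − πN⁻ ∈ yI i LA`. [folklore] -/
private theorem mem_yI (i : ℕ) (LA : MI) :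
    MI.mem SC ((((theta0 (aI i) LA).hi + RHI : ℤ) : ℝ) / SC + π - π * (nLo (aI i) : ℝ)) (yI i LA) := by
  have h := MI.mem_sub (MI.mem_add (MI.mem_ofScaled SC_pos ((theta0 (aI i) LA).hi + RHI)) mem_piI)
    (MI.mem_mulInt mem_piI (nLo (aI i)))
  unfold yI
  convert h using 2
  push_cast
  ring

/-- `π(2.067 + 0.059 log a) ∈ cI LA` for `LA ∋ log a`. [folklore] -/
private theorem mem_cI {a : ℝ} {LA : MI} (hLA : MI.mem SC (Real.log a) LA) :
    MI.mem SC (π * (2.067 + 0.059 * Real.log a)) (cI LA) := by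
  have h := MI.mem_mul SC_pos mem_piI (MI.mem_add (MI.mem_ofFrac SC 2067 (q := 1000) (by norm_num))
    (MI.mem_divNat (MI.mem_mulInt hLA 59) (n := 1000) (by norm_num)))
  unfold cI
  convert h using 2
  push_cast
  ring

/-- **Soundness of `cellOk i`**: if the test passes then `|∫_{168π}^T S| ≤ 2.067 + 0.059 log T` on the
cell `[aR i, bR i]`. [cite: BrentPlattTrudgian2021, §2 eq. (2.9)] -/
private theorem cellOk_sound {i : ℕ} (hi : i < NCELL) (h : cellOk i = true) :
    ∀ T ∈ Icc (aR i) (bR i), |∫ t in (168 * π)..T, zetaArgS t| ≤ 2.067 + 0.059 * Real.log T := by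
  have hS := SC_pos
  have hSr : (0 : ℝ) < SC := by exact_mod_cast SC_pos
  have hπ := Real.pi_pos
  have hπ3 : 3 < π := Real.pi_gt_three
  obtain ⟨ha, hbU, hh⟩ := cell_geometry hi
  have ha0 : 0 < aR i := by linarith
  have hT0 : (heightT0 : ℝ) = 2516 := by norm_num [heightT0]
  -- we may assume `a ≤ b` (else the cell is empty)
  by_cases hab : aR i ≤ bR i
  swap
  · intro T hT; exact absurd (hT.1.trans hT.2) hab
  have hb2π : 2 * π ≤ bR i := ha.trans hab
  have hπ4 : π < 3.15 := Real.pi_lt_d2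
  have haT : aR i ≤ heightT0 := by rw [hT0]; linarith
  have hbT : bR i ≤ heightT0 := by rw [hT0]; linarith
  unfold cellOk at h
  split at h
  · rename_i LU LA LB hLU hLA hLB
    rw [Bool.and_eq_true, decide_eq_true_eq, decide_eq_true_eq] at h
    obtain ⟨hup, hdn⟩ := h
    -- the logarithms
    obtain ⟨-, hlogU⟩ := MI.mem_logPos hS hLU mem_uI
    obtain ⟨-, hloga⟩ := MI.mem_logPos hS hLA (mem_aI i)
    obtain ⟨hb0, hlogb⟩ := MI.mem_logPos hS hLB (mem_bI i)
    -- the enclosures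
    have hJ := mem_jbI hlogU hlogb hb2π hbU
    have hθ := mem_theta0 (mem_aI i) hloga
    have hX := (mem_xI i LA).2
    have hY := (mem_yI i LA).2
    have hC := (mem_cI hloga).1
    have elog : Real.log (aR i / (2 * π)) = Real.log (aR i) - Real.log (2 * π) :=
      Real.log_div ha0.ne' (by positivity)
    have hNa := (count_bounds (mem_aI i) ha0.le haT).1
    have hNb := (count_bounds (mem_bI i) hb0.le hbT).2
    have hRLO : (0.687512 : ℝ) * SC ≤ (RLO : ℝ) := by norm_num [RLO, SC]
    have hRHI : (0.690842 : ℝ) * SC ≤ (RHI : ℝ) := by norm_num [RHI, SC]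
    -- casts of the two integer tests
    have hup' : ((jbI i LU LB).hi : ℝ) * 4 + max (0 : ℝ) ((xI i LA).hi : ℝ) ≤ ((cI LA).lo : ℝ) * 4 := by
      have := hup; exact_mod_cast this
    have hdn' : -((jbI i LU LB).lo : ℝ) * 4 + max (0 : ℝ) ((yI i LA).hi : ℝ) ≤ ((cI LA).lo : ℝ) * 4 := by
      have := hdn; exact_mod_cast this
    set c : ℝ := (((theta0 (aI i) LA).lo - RLO : ℤ) : ℝ) / SC with hc
    set d : ℝ := (((theta0 (aI i) LA).hi + RHI : ℤ) : ℝ) / SC with hd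
    -- apply the analytic cell lemma
    refine abs_integral_zetaArgS_le_of_cell ha hbU hh hNa hNb (θlo := c + 0.687512) (θhi := d - 0.690842)
      (Jlo := ((jbI i LU LB).lo : ℝ) / SC) (Jhi := ((jbI i LU LB).hi : ℝ) / SC)
      (C := ((cI LA).lo : ℝ) / SC) ?_ ?_ ((div_le_iff₀ hSr).2 hJ.1) ((le_div_iff₀ hSr).2 hJ.2)
      ((div_le_iff₀ hSr).2 hC) ?_ ?_
    · -- `θlo ≤ θ₀(a)`
      rw [elog, hc, div_add' _ _ _ hSr.ne', div_le_iff₀ hSr]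
      have := hθ.1
      push_cast at this ⊢
      linarith
    · -- `θ₀(a) ≤ θhi`
      rw [elog, hd, le_sub_iff_add_le, le_div_iff₀ hSr]
      have := hθ.2
      push_cast at this ⊢
      linarith
    · -- the `up` test
      have e1 : c + 0.687512 - 0.687512 = c := by ring
      rw [e1]
      have k1 : max 0 (π * (nHi (bI i) : ℝ) - c - π) ≤ max (0 : ℝ) ((xI i LA).hi : ℝ) / SC := by
        rw [le_div_iff₀ hSr, max_mul_of_nonneg _ _ hSr.le, zero_mul]
        exact max_le_max le_rfl hX
      have k2 : ((jbI i LU LB).hi : ℝ) + 1 / 4 * max (0 : ℝ) ((xI i LA).hi : ℝ) ≤ ((cI LA).lo : ℝ) := by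
        linarith
      have k3 := div_le_div_of_nonneg_right k2 hSr.le
      rw [add_div, mul_div_assoc] at k3
      linarith
    · -- the `down` test
      have e1 : d - 0.690842 + 0.690842 = d := by ring
      rw [e1]
      have k1 : max 0 (d + π - π * (nLo (aI i) : ℝ)) ≤ max (0 : ℝ) ((yI i LA).hi : ℝ) / SC := by
        rw [le_div_iff₀ hSr, max_mul_of_nonneg _ _ hSr.le, zero_mul]
        exact max_le_max le_rfl hY
      have k2 : -((jbI i LU LB).lo : ℝ) + 1 / 4 * max (0 : ℝ) ((yI i LA).hi : ℝ) ≤ ((cI LA).lo : ℝ) := by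
        linarith
      have k3 := div_le_div_of_nonneg_right k2 hSr.le
      rw [add_div, mul_div_assoc, neg_div] at k3
      linarith
  · exact absurd h (by simp)

/-! ## Assembly -/

/-- Every `T ∈ [2π, 168π]` lies in some cell. [folklore] -/
private theorem exists_cell {T : ℝ} (h1 : 2 * π ≤ T) (h2 : T ≤ 168 * π) :
    ∃ i < NCELL, T ∈ Icc (aR i) (bR i) := by
  have hπ1 : 3.14159 < π := by linarith [Real.pi_gt_d6]
  by_cases hT : T ≤ 26 / 4
  · refine ⟨0, by norm_num [NCELL], ?_, ?_⟩
    · simpa [aR] using h1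
    · simp only [bR, NCELL, show (0 + 1 ≠ 2087) by norm_num, if_false]
      norm_num at hT ⊢; exact hT
  push Not at hT
  have hT0 : 0 ≤ 4 * T := by linarith
  set m : ℕ := ⌊4 * T⌋₊ with hm
  have hm1 : (m : ℝ) ≤ 4 * T := Nat.floor_le hT0
  have hm2 : 4 * T < m + 1 := Nat.lt_floor_add_one (4 * T)
  have hm26 : 26 ≤ m := by
    rw [hm]; exact Nat.le_floor (by push_cast; linarith)
  by_cases hbig : 2111 ≤ m
  · refine ⟨2086, by norm_num [NCELL], ?_, ?_⟩
    · simp only [aR, show (2086 ≠ 0) by norm_num, if_false]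
      have : (2111 : ℝ) ≤ m := by exact_mod_cast hbig
      push_cast; linarith
    · simpa [bR, NCELL] using h2
  push Not at hbig
  refine ⟨m - 25, by unfold NCELL; omega, ?_, ?_⟩
  · have hne : m - 25 ≠ 0 := by omega
    simp only [aR, hne, if_false]
    have : ((25 + (m - 25) : ℕ) : ℝ) = m := by
      rw [show 25 + (m - 25) = m by omega]
    rw [this]; linarith
  · have hne : m - 25 + 1 ≠ NCELL := by unfold NCELL; omega
    simp only [bR, hne, if_false]
    have : ((26 + (m - 25) : ℕ) : ℝ) = m + 1 := by
      rw [show 26 + (m - 25) = m + 1 by omega]; push_cast; ring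
    rw [this]; linarith

end S1LowNumerics

open S1LowNumerics in
/-- **Brent–Platt–Trudgian's (2.9) on the initial range**: for `2π ≤ T ≤ 168π`,
`|∫_{168π}^T S(t) dt| ≤ 2.067 + 0.059 log T` — the "small computation", done in the kernel's
arithmetic over the tree's certified zeros. [cite: BrentPlattTrudgian2021, §2 eq. (2.9)] -/
theorem abs_integral_zetaArgS_from_168pi_le_of_le_168pi {T : ℝ} (h1 : 2 * π ≤ T) (h2 : T ≤ 168 * π) :
    |∫ t in (168 * π)..T, zetaArgS t| ≤ 2.067 + 0.059 * Real.log T := by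
  obtain ⟨i, hi, hT⟩ := S1LowNumerics.exists_cell h1 h2
  have hall := S1LowNumerics.checkAll_eq_true
  unfold S1LowNumerics.checkAll at hall
  rw [List.all_eq_true] at hall
  exact S1LowNumerics.cellOk_sound hi (hall i (List.mem_range.2 hi)) T hT

/-- **Brent–Platt–Trudgian 2021, the standing condition (2.9) on `[2π, ∞)` — DISCHARGED**:
`∀ T ≥ 2π, |∫_{168π}^T S(t) dt| ≤ 2.067 + 0.059 log T`. Beyond `168π` this is Trudgian 2011,
Thm 2.2 (the tree's theorem `abs_integral_zetaArgS_le_trudgian_holds`, lower limit by continuity);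
on `[2π, 168π]` it is the kernel computation above. The named fact `BrentPlattTrudgian2021_eq29` is a
theorem. [cite: BrentPlattTrudgian2021, §2 eq. (2.9)] [cite: Trudgian2011, Thm. 2.2] -/
theorem BrentPlattTrudgian2021_eq29_holds : BrentPlattTrudgian2021_eq29 := by
  intro T hT
  rcases le_or_gt T (168 * π) with h | h
  · exact abs_integral_zetaArgS_from_168pi_le_of_le_168pi hT h
  · exact abs_integral_zetaArgS_from_168pi_le_of_lt h

namespace S1LowNumerics

/-! ## `S₁` at small height: the certificate (computable) -/

/-- The box `W + j`. [folklore] -/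
def shiftBox (W : MC) (j : ℕ) : MC := W.add (MC.ofInt SC (j : ℤ))

/-- Enclosure of `Σ_{i<j} ((w+i) log(w+i) − (w+i))` for `w ∈ W` in the open upper half-plane.
[folklore] -/
def hSum (W : MC) : ℕ → Option MC
  | 0 => some (MC.ofInt SC 0)
  | j + 1 =>
    match hSum W j, MC.logUpper SC KLOG piI (shiftBox W j) with
    | some acc, some L => some (acc.add ((MC.mul SC (shiftBox W j) L).sub (shiftBox W j)))
    | _, _ => none

/-- Enclosure of `H(w) = (w+16)²/2·log(w+16) − 3(w+16)²/4 − Σ_{j<16}((w+j)log(w+j) − (w+j))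
− ((w+16)log(w+16) − (w+16))/2 + log(w+16)/12 + 1/(720(w+16)²)` (the closed-form primitive of
`RiemannSiegelThetaSmallHeight`). [folklore] -/
def hBox (W : MC) : Option MC :=
  match MC.logUpper SC KLOG piI (shiftBox W 16), hSum W 16,
    MC.divBox SC (MC.ofInt SC 1) ((MC.sqr SC (shiftBox W 16)).mulInt 720) with
  | some LV, some Sg, some R =>
    some (((((((MC.mul SC (MC.sqr SC (shiftBox W 16)) LV).divNat 2).sub
      (((MC.sqr SC (shiftBox W 16)).mulInt 3).divNat 4)).sub Sg).sub
      (((MC.mul SC (shiftBox W 16) LV).sub (shiftBox W 16)).divNat 2)).add (LV.divNat 12)).add R)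
  | _, _, _ => none

/-- `j + ¼`. [folklore] -/
def qI (j : ℕ) : MI := MI.ofFrac SC ((4 * j + 1 : ℕ) : ℤ) 4

/-- Enclosure of `Σ_{i<j} ((¼+i) log(¼+i) − (¼+i))`. [folklore] -/
def hSumR : ℕ → Option MI
  | 0 => some (MI.ofInt SC 0)
  | j + 1 =>
    match hSumR j, MI.logPos SC KLOG (qI j) with
    | some acc, some L => some (acc.add ((MI.mul SC (qI j) L).sub (qI j)))
    | _, _ => none

/-- Enclosure of `Re H(¼)` (`720 · (65/4)² = 190125`). [folklore] -/
def hQuarter : Option MI :=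
  match MI.logPos SC KLOG (qI 16), hSumR 16 with
  | some LV, some Sg =>
    some (((((((MI.mul SC (MI.mul SC (qI 16) (qI 16)) LV).divNat 2).sub
      (((MI.mul SC (qI 16) (qI 16)).mulInt 3).divNat 4)).sub Sg).sub
      (((MI.mul SC (qI 16) LV).sub (qI 16)).divNat 2)).add (LV.divNat 12)).add
      (MI.ofFrac SC 1 190125))
  | _, _ => none

/-- `2⁴⁵ ≥ 3.6·10⁻⁸ · 49 · 2⁶⁴` (closed-form error of `πS₁(T)`, `T ≤ 14`). [folklore] -/
def ES1 : ℤ := 35184372088832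

/-- Enclosure of `πS₁(T) = 2(Re H(¼+iT/2) − Re H(¼)) + (log π)T²/4 − πT ± 3.6·10⁻⁸T²/4` from
`W ∋ ¼ + iT/2`, `TT ∋ T` (`0 ≤ T ≤ 14`). [folklore] -/
def piS1Box (W : MC) (TT : MI) : Option MI :=
  match hBox W, hQuarter, MI.logPos SC KLOG piI with
  | some HW, some HQ, some LP =>
    some (((((HW.re.sub HQ).mulInt 2).add ((MI.mul SC LP (MI.mul SC TT TT)).divNat 4)).sub
      (MI.mul SC piI TT)).widen ES1)
  | _, _, _ => none

/-- The box `¼ + i k/16` (grid point `T = k/8`). [folklore] -/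
def wGrid (k : ℕ) : MC := ⟨MI.ofFrac SC 1 4, MI.ofFrac SC (k : ℤ) 16⟩

/-- The grid point `T = k/8`. [folklore] -/
def tGrid (k : ℕ) : MI := MI.ofFrac SC (k : ℤ) 8

/-- The box `¼ + iπ` (`T = 2π`). [folklore] -/
def w2Pi : MC := ⟨MI.ofFrac SC 1 4, piI⟩

/-- `⌈17.2125 · 2⁶⁴⌉` (`|θ| ≤ 2.7 · 6.375` on `[0, 6.375]`). [folklore] -/
def CTH : ℤ := 317514582368725657191

/-- The test on a grid cell from the enclosure `P ∋ πS₁(k/8)`: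
`1000 · (8·max(−P⁻, P⁺) + (π⁺ + 17.2125)) ≤ 8 · 3054 · π⁻`. [folklore] -/
def gridTest (P : MI) : Bool :=
  decide (1000 * (8 * max (-P.lo) P.hi + (piI.hi + CTH)) ≤ 8 * 3054 * piI.lo)

/-- The test on the grid cell `[k/8, (k+1)/8]` (written with `Option.elim`, not `match`: the
equation lemma of a `match` on this computed discriminant makes the elaborator unfold `k · 2⁶⁴`).
[folklore] -/
def gridOk (k : ℕ) : Bool := (piS1Box (wGrid k) (tGrid k)).elim false gridTest

/-- All `43` grid cells (`k = 8, …, 50`, covering `[1, 6.375] ⊇ [1, 2π]`) pass. [folklore] -/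
def gridAll : Bool := (List.range 43).all fun i ↦ gridOk (i + 8)

/-- `Θ₃(x)` including the `−7/(11520x²)` term, from `X ∋ x`, `LX ∋ log x`. [folklore] -/
def thetaInt3 (X LX : MI) : Option MI :=
  match MI.divPos SC (MI.ofInt SC 7) ((MI.mul SC X X).mulInt 11520) with
  | some C => some ((thetaInt X LX).sub C)
  | none => none

/-- `⌈1.6·10⁻⁵ · 2⁶⁴⌉` (error of the sharp closed form). [folklore] -/
def WJ3 : ℤ := 295147905179353

/-- Enclosure of `π∫_{2π}^{168π} S` (sharp closed form). [folklore] -/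
def j2PiBox : Option MI :=
  match MI.logPos SC KLOG uI with
  | some LU =>
    match thetaInt3 uI LU, thetaInt3 twoPiI log2PiI with
    | some TU, some T2 =>
      some ((((MI.mul SC piI ⟨sumLo twoPiI, sumHi twoPiI⟩).sub (TU.sub T2)).sub
        (MI.mul SC piI (uI.sub twoPiI))).widen WJ3)
    | _, _ => none
  | none => none

/-- Enclosure of `πS₁(168π) = πS₁(2π) + π∫_{2π}^{168π} S`. [folklore] -/
def piS1UBox : Option MI :=
  match piS1Box w2Pi twoPiI, j2PiBox with
  | some P, some J => some (P.add J)
  | _, _ => none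

/-- The tests at `168π`: `|πS₁(168π)| ≤ 0.987π⁻` and `πS₁(168π) ∈ [−0.98663π⁻, −0.9866π⁺]`.
[folklore] -/
def s1UOk : Bool :=
  match piS1UBox with
  | some P => decide (max (-P.lo) P.hi * 1000 ≤ 987 * piI.lo) &&
      (decide (-(98663 * piI.lo) ≤ 100000 * P.lo) && decide (10000 * P.hi ≤ -(9866 * piI.hi)))
  | none => false

/-- **The compiled evaluation** (the `43` grid cells and the tests at `168π`).
[cite: Simonic2022, eq. (1.7) (footnote: `|S₁(168π)| ≤ 0.987`, (1.7) on `[1, 168π]`)] -/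
theorem s1Checks_eq_true : gridAll = true ∧ s1UOk = true := by
  constructor <;> native_decide

/-! ## `S₁` at small height: soundness -/

/-- `z + j ∈ shiftBox W j` for `z ∈ W`. [folklore] -/
private theorem mem_shiftBox {z : ℂ} {W : MC} (hz : MC.mem SC z W) (j : ℕ) :
    MC.mem SC (z + j) (shiftBox W j) := by
  have h := MC.mem_add hz (MC.mem_ofInt SC (j : ℤ))
  rw [Int.cast_natCast] at h
  exact h

/-- `Σ_{i<j} ((z+i) log(z+i) − (z+i)) ∈ hSum W j` for `z ∈ W` (when `some`). [folklore] -/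
private theorem mem_hSum {z : ℂ} {W : MC} (hz : MC.mem SC z W) :
    ∀ (j : ℕ) {Y : MC}, hSum W j = some Y →
      MC.mem SC (∑ i ∈ Finset.range j, ((z + i) * Complex.log (z + i) - (z + i))) Y := by
  intro j
  induction j with
  | zero =>
    intro Y h
    rw [hSum, Option.some.injEq] at h
    subst h
    rw [Finset.sum_range_zero]
    have h0 := MC.mem_ofInt SC 0
    rw [Int.cast_zero] at h0
    exact h0
  | succ j ih =>
    intro Y h
    rw [hSum] at h
    split at h
    · rename_i acc L hacc hL
      simp only [Option.some.injEq] at h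
      subst h
      have hw := mem_shiftBox hz j
      have hlog := (MC.mem_logUpper SC_pos mem_piI hL hw).2
      rw [Finset.sum_range_succ]
      exact MC.mem_add (ih hacc) (MC.mem_sub (MC.mem_mul SC_pos hw hlog) hw)
    · exact absurd h (by simp)

/-- `H(z) ∈ hBox W` for `z ∈ W` (when `some`). [folklore] -/
private theorem mem_hBox {z : ℂ} {W Y : MC} (hz : MC.mem SC z W) (h : hBox W = some Y) :
    MC.mem SC ((z + 16) ^ 2 / 2 * Complex.log (z + 16) - 3 * (z + 16) ^ 2 / 4
      - ∑ j ∈ Finset.range 16, ((z + j) * Complex.log (z + j) - (z + j))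
      - ((z + 16) * Complex.log (z + 16) - (z + 16)) / 2
      + Complex.log (z + 16) / 12 + 1 / (720 * (z + 16) ^ 2)) Y := by
  have hS := SC_pos
  unfold hBox at h
  split at h
  · rename_i LV Sg R hLV hSg hR
    simp only [Option.some.injEq] at h
    subst h
    have hV : MC.mem SC (z + 16) (shiftBox W 16) := by
      have := mem_shiftBox hz 16
      rw [Nat.cast_ofNat] at this
      exact this
    have hV2 := MC.mem_sqr hS hV
    have hlog := (MC.mem_logUpper hS mem_piI hLV hV).2
    have hsum := mem_hSum hz 16 hSg
    have hRm := MC.mem_divBox hS hR (MC.mem_ofInt SC 1) (MC.mem_mulInt hV2 720)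
    have t1 := MC.mem_divNat (MC.mem_mul hS hV2 hlog) (n := 2) (by norm_num)
    have t2 := MC.mem_divNat (MC.mem_mulInt hV2 3) (n := 4) (by norm_num)
    have t4 := MC.mem_divNat (MC.mem_sub (MC.mem_mul hS hV hlog) hV) (n := 2) (by norm_num)
    have t5 := MC.mem_divNat hlog (n := 12) (by norm_num)
    have hfin := MC.mem_add (MC.mem_add (MC.mem_sub (MC.mem_sub (MC.mem_sub t1 t2) hsum) t4) t5) hRm
    convert hfin using 1
    push_cast
    ring
  · exact absurd h (by simp)

/-- `¼ + j ∈ qI j`. [folklore] -/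
private theorem mem_qI (j : ℕ) : MI.mem SC (1 / 4 + j) (qI j) := by
  have h := MI.mem_ofFrac SC ((4 * j + 1 : ℕ) : ℤ) (q := 4) (by norm_num)
  have e : (((4 * j + 1 : ℕ) : ℤ) : ℝ) / (4 : ℕ) = 1 / 4 + j := by push_cast; ring
  rw [e] at h
  exact h

/-- `Σ_{i<j} ((¼+i) log(¼+i) − (¼+i)) ∈ hSumR j` (when `some`). [folklore] -/
private theorem mem_hSumR :
    ∀ (j : ℕ) {Y : MI}, hSumR j = some Y →
      MI.mem SC (∑ i ∈ Finset.range j, ((1 / 4 + i) * Real.log (1 / 4 + i) - (1 / 4 + i))) Y := by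
  intro j
  induction j with
  | zero =>
    intro Y h
    rw [hSumR, Option.some.injEq] at h
    subst h
    rw [Finset.sum_range_zero]
    have h0 := MI.mem_ofInt SC 0
    rw [Int.cast_zero] at h0
    exact h0
  | succ j ih =>
    intro Y h
    rw [hSumR] at h
    split at h
    · rename_i acc L hacc hL
      simp only [Option.some.injEq] at h
      subst h
      have hq := mem_qI j
      have hlog := (MI.mem_logPos SC_pos hL hq).2
      rw [Finset.sum_range_succ]
      exact MI.mem_add (ih hacc) (MI.mem_sub (MI.mem_mul SC_pos hq hlog) hq)
    · exact absurd h (by simp)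

/-- `Re H(¼) ∈ hQuarter` (when `some`; via `re_stirlingH_quarter`). [folklore] -/
private theorem mem_hQuarter {Y : MI} (h : hQuarter = some Y) :
    MI.mem SC (((fun z : ℂ ↦ (z + 16) ^ 2 / 2 * Complex.log (z + 16) - 3 * (z + 16) ^ 2 / 4
        - ∑ j ∈ Finset.range 16, ((z + j) * Complex.log (z + j) - (z + j))
        - ((z + 16) * Complex.log (z + 16) - (z + 16)) / 2
        + Complex.log (z + 16) / 12 + 1 / (720 * (z + 16) ^ 2)) ((1 / 4 : ℝ) : ℂ)).re) Y := by
  rw [re_stirlingH_quarter]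
  have hS := SC_pos
  unfold hQuarter at h
  split at h
  · rename_i LV Sg hLV hSg
    simp only [Option.some.injEq] at h
    subst h
    have hV : MI.mem SC (1 / 4 + 16) (qI 16) := by
      have := mem_qI 16
      rw [Nat.cast_ofNat] at this
      exact this
    have hV2 := MI.mem_mul hS hV hV
    have hlog := (MI.mem_logPos hS hLV hV).2
    have hsum := mem_hSumR 16 hSg
    have hRm := MI.mem_ofFrac SC 1 (q := 190125) (by norm_num)
    have t1 := MI.mem_divNat (MI.mem_mul hS hV2 hlog) (n := 2) (by norm_num)
    have t2 := MI.mem_divNat (MI.mem_mulInt hV2 3) (n := 4) (by norm_num)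
    have t4 := MI.mem_divNat (MI.mem_sub (MI.mem_mul hS hV hlog) hV) (n := 2) (by norm_num)
    have t5 := MI.mem_divNat hlog (n := 12) (by norm_num)
    have hfin := MI.mem_add (MI.mem_add (MI.mem_sub (MI.mem_sub (MI.mem_sub t1 t2) hsum) t4) t5) hRm
    convert hfin using 1
    push_cast
    ring
  · exact absurd h (by simp)

/-- `πS₁(T) ∈ piS1Box W TT` for `0 ≤ T ≤ 14`, `¼ + iT/2 ∈ W`, `T ∈ TT`.
[cite: Simonic2022, eq. (1.7) (footnote)] -/
private theorem mem_piS1Box {T : ℝ} {W : MC} {TT P : MI} (h0 : 0 ≤ T) (h14 : T ≤ 14)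
    (hW : MC.mem SC (((1 / 4 : ℝ) : ℂ) + (T / 2 : ℝ) * I) W) (hT : MI.mem SC T TT)
    (h : piS1Box W TT = some P) : MI.mem SC (π * ∫ t in (0 : ℝ)..T, zetaArgS t) P := by
  have hS := SC_pos
  have herr := abs_pi_mul_integral_zetaArgS_small_le h0 h14
  beta_reduce at herr
  unfold piS1Box at h
  split at h
  · rename_i HW HQ LP hHW hHQ hLP
    simp only [Option.some.injEq] at h
    subst h
    have h1 := (mem_hBox hW hHW).1
    have h2 := mem_hQuarter hHQ
    beta_reduce at h2
    have hlp := (MI.mem_logPos hS hLP mem_piI).2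
    have hmain := MI.mem_sub (MI.mem_add (MI.mem_mulInt (MI.mem_sub h1 h2) 2)
      (MI.mem_divNat (MI.mem_mul hS hlp (MI.mem_mul hS hT hT)) (n := 4) (by norm_num)))
      (MI.mem_mul hS mem_piI hT)
    refine MI.mem_widen hmain ?_
    have hT2 : T ^ 2 ≤ 196 := by nlinarith
    have hE : (3.6e-8 * T ^ 2 / 4) * (SC : ℝ) ≤ (ES1 : ℝ) := by
      have hSe : ((SC : ℕ) : ℝ) = 18446744073709551616 := by norm_num [SC]
      have hEe : ((ES1 : ℤ) : ℝ) = 35184372088832 := by norm_num [ES1]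
      rw [hSe, hEe]
      nlinarith
    refine le_trans ?_ hE
    refine mul_le_mul_of_nonneg_right ?_ (by positivity)
    refine le_trans (le_of_eq ?_) herr
    congr 1
    push_cast
    ring
  · exact absurd h (by simp)

/-- `¼ + i(k/8)/2 ∈ wGrid k`. [folklore] -/
private theorem mem_wGrid (k : ℕ) :
    MC.mem SC (((1 / 4 : ℝ) : ℂ) + (((k : ℝ) / 8) / 2 : ℝ) * I) (wGrid k) := by
  have h1 := MI.mem_ofFrac SC 1 (q := 4) (by norm_num)
  have h2 := MI.mem_ofFrac SC (k : ℤ) (q := 16) (by norm_num)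
  refine ⟨?_, ?_⟩
  · show MI.mem SC _ (MI.ofFrac SC 1 4)
    convert h1 using 2
    simp
  · show MI.mem SC _ (MI.ofFrac SC (k : ℤ) 16)
    convert h2 using 2
    simp
    ring

/-- `k/8 ∈ tGrid k`. [folklore] -/
private theorem mem_tGrid (k : ℕ) : MI.mem SC ((k : ℝ) / 8) (tGrid k) := by
  have h := MI.mem_ofFrac SC (k : ℤ) (q := 8) (by norm_num)
  rw [Int.cast_natCast, Nat.cast_ofNat] at h
  exact h

/-- `¼ + i(2π)/2 ∈ w2Pi`. [folklore] -/
private theorem mem_w2Pi : MC.mem SC (((1 / 4 : ℝ) : ℂ) + ((2 * π) / 2 : ℝ) * I) w2Pi := by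
  have h1 := MI.mem_ofFrac SC 1 (q := 4) (by norm_num)
  refine ⟨?_, ?_⟩
  · show MI.mem SC _ (MI.ofFrac SC 1 4)
    convert h1 using 2
    simp
  · show MI.mem SC _ piI
    convert mem_piI using 2
    simp

/-- `|θ(u)| ≤ 2.7u` on `[0, 7]` (mean value inequality, `|θ'| ≤ 2.7` there, `θ(0) = 0`).
[folklore] -/
private theorem abs_riemannSiegelTheta_le_small {u : ℝ} (h0 : 0 ≤ u) (h7 : u ≤ 7) :
    |riemannSiegelTheta u| ≤ 2.7 * u := by
  have h := norm_image_sub_le_of_norm_deriv_le_segment' (f := riemannSiegelTheta)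
    (f' := riemannSiegelThetaDeriv) (a := 0) (b := 7) (C := 2.7)
    (fun x _ ↦ (hasDerivAt_riemannSiegelTheta_holds x).hasDerivWithinAt)
    (fun x hx ↦ by
      rw [Real.norm_eq_abs]
      exact abs_riemannSiegelThetaDeriv_le_small hx.1 hx.2.le) u ⟨h0, h7⟩
  rw [riemannSiegelTheta_zero, sub_zero, Real.norm_eq_abs, sub_zero] at h
  exact h

/-- `|π∫_s^t S| ≤ (π + 17.2125)(t − s)` for `0 ≤ s ≤ t ≤ 6.375` (`N = 0`, `|θ| ≤ 2.7·6.375`).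
[folklore] -/
private theorem abs_pi_mul_integral_zetaArgS_le_lip {s t : ℝ} (h0 : 0 ≤ s) (hst : s ≤ t)
    (ht : t ≤ 6.375) : |π * ∫ u in s..t, zetaArgS u| ≤ (π + 17.2125) * (t - s) := by
  have hπ := Real.pi_pos
  rw [pi_mul_integral_zetaArgS_eq_count_sub_theta]
  have hN : ∫ u in s..t, (zetaZeroCount u : ℝ) = 0 := by
    rw [intervalIntegral.integral_congr (g := fun _ ↦ (0 : ℝ)) (fun u hu ↦ ?_)]
    · simp
    · rw [uIcc_of_le hst] at hu
      have h1 := zetaZeroCount_mono (show u ≤ 14 by linarith [hu.2])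
      rw [zetaZeroCount_fourteen] at h1
      simp [Nat.le_zero.1 h1]
  have hθ : |∫ u in s..t, riemannSiegelTheta u| ≤ 17.2125 * (t - s) := by
    have h := intervalIntegral.norm_integral_le_of_norm_le_const (a := s) (b := t) (C := 17.2125)
      (f := riemannSiegelTheta) (fun u hu ↦ ?_)
    · rw [Real.norm_eq_abs, abs_of_nonneg (sub_nonneg.2 hst)] at h
      exact h
    · rw [uIoc_of_le hst] at hu
      rw [Real.norm_eq_abs]
      have := abs_riemannSiegelTheta_le_small (u := u) (by linarith [hu.1]) (by linarith [hu.2])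
      nlinarith [hu.2]
  rw [hN, mul_zero, zero_sub]
  rw [abs_le] at hθ ⊢
  constructor <;> nlinarith [hθ.1, hθ.2]

/-- A passing grid cell: `|πS₁(t)| ≤ 3.054π` on `[k/8, k/8 + 1/8]` (`k ≤ 50`). [folklore] -/
private theorem gridOk_sound {k : ℕ} (hk : k ≤ 50) (h : gridOk k = true) :
    ∀ t ∈ Icc ((k : ℝ) / 8) ((k : ℝ) / 8 + 1 / 8),
      |π * ∫ u in (0 : ℝ)..t, zetaArgS u| ≤ 3.054 * π := by
  have hSr : (0 : ℝ) < SC := by exact_mod_cast SC_pos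
  have hπ := Real.pi_pos
  have hk' : (k : ℝ) ≤ 50 := by exact_mod_cast hk
  cases hP : piS1Box (wGrid k) (tGrid k) with
  | none => rw [gridOk, hP, Option.elim_none] at h; exact absurd h (by simp)
  | some P =>
    rw [gridOk, hP, Option.elim_some, gridTest, decide_eq_true_eq] at h
    have hT0 : (0 : ℝ) ≤ (k : ℝ) / 8 := by positivity
    have hmem := mem_piS1Box hT0 (by linarith) (mem_wGrid k) (mem_tGrid k) hP
    intro t ht
    have h' : (1000 : ℝ) * (8 * max (-(P.lo : ℝ)) (P.hi : ℝ) + ((piI.hi : ℝ) + (CTH : ℝ)))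
        ≤ 8 * 3054 * (piI.lo : ℝ) := by
      have := h; exact_mod_cast this
    have hCTH : (17.2125 : ℝ) * SC ≤ (CTH : ℝ) := by
      have hSe : ((SC : ℕ) : ℝ) = 18446744073709551616 := by norm_num [SC]
      have hCe : ((CTH : ℤ) : ℝ) = 317514582368725657191 := by norm_num [CTH]
      rw [hSe, hCe]; norm_num
    obtain ⟨hp1, hp2⟩ := mem_piI
    obtain ⟨hm1, hm2⟩ := hmem
    have hts : t - (k : ℝ) / 8 ≤ 1 / 8 := by linarith [ht.2]
    have hlip := abs_pi_mul_integral_zetaArgS_le_lip hT0 ht.1 (by linarith [ht.2])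
    have hsplit : ∫ u in (0 : ℝ)..t, zetaArgS u =
        (∫ u in (0 : ℝ)..((k : ℝ) / 8), zetaArgS u) + ∫ u in ((k : ℝ) / 8)..t, zetaArgS u :=
      (intervalIntegral.integral_add_adjacent_intervals (intervalIntegrable_zetaArgS _ _)
        (intervalIntegrable_zetaArgS _ _)).symm
    rw [hsplit, mul_add]
    set A := ∫ u in (0 : ℝ)..((k : ℝ) / 8), zetaArgS u with hA_def
    set B := ∫ u in ((k : ℝ) / 8)..t, zetaArgS u with hB_def
    set M := max (-(P.lo : ℝ)) (P.hi : ℝ) with hM_def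
    have hM1 := le_max_left (-(P.lo : ℝ)) (P.hi : ℝ)
    have hM2 := le_max_right (-(P.lo : ℝ)) (P.hi : ℝ)
    have hA : |π * A * SC| ≤ M := abs_le.2 ⟨by linarith, by linarith⟩
    rw [abs_mul, abs_of_pos hSr] at hA
    have hB : |π * B| * SC ≤ (π + 17.2125) / 8 * SC := by
      refine mul_le_mul_of_nonneg_right (hlip.trans ?_) hSr.le
      have : (π + 17.2125) * (t - (k : ℝ) / 8) ≤ (π + 17.2125) * (1 / 8) :=
        mul_le_mul_of_nonneg_left hts (by positivity)
      linarith
    have key : M + (π + 17.2125) / 8 * SC ≤ 3.054 * π * SC := by linarith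
    have habs := abs_add_le (π * A) (π * B)
    have hsum : |π * A + π * B| * SC ≤ 3.054 * π * SC := by nlinarith
    exact le_of_mul_le_mul_right hsum hSr

/-- From `gridAll`: `|πS₁(t)| ≤ 3.054π` on `[1, 6.375]`. [folklore] -/
private theorem gridAll_sound (h : gridAll = true) {t : ℝ} (h1 : 1 ≤ t) (h2 : t ≤ 6.375) :
    |π * ∫ u in (0 : ℝ)..t, zetaArgS u| ≤ 3.054 * π := by
  obtain ⟨k, hk8, hk50, hkt, htk⟩ :
      ∃ k : ℕ, 8 ≤ k ∧ k ≤ 50 ∧ (k : ℝ) / 8 ≤ t ∧ t ≤ (k : ℝ) / 8 + 1 / 8 := by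
    by_cases h50 : (50 : ℝ) / 8 ≤ t
    · exact ⟨50, by norm_num, le_rfl, by push_cast; linarith, by push_cast; linarith⟩
    · have h50' : t < 50 / 8 := not_le.1 h50
      have h8 : (0 : ℝ) ≤ 8 * t := by linarith
      refine ⟨⌊8 * t⌋₊, ?_, ?_, ?_, ?_⟩
      · exact Nat.le_floor (by push_cast; linarith)
      · exact (Nat.floor_lt h8 |>.2 (by push_cast; linarith)).le
      · have := Nat.floor_le h8
        linarith
      · have := Nat.lt_floor_add_one (8 * t)
        linarith
  unfold gridAll at h
  rw [List.all_eq_true] at h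
  have hk : gridOk (k - 8 + 8) = true := h (k - 8) (List.mem_range.2 (by omega))
  rw [show k - 8 + 8 = k by omega] at hk
  exact gridOk_sound hk50 hk t ⟨hkt, htk⟩

/-- `Θ₃(x)` (with the `−7/(11520x²)` term) `∈ thetaInt3 X LX` for `x ∈ X`, `log x ∈ LX` (when `some`).
[folklore] -/
private theorem mem_thetaInt3 {x : ℝ} {X LX Y : MI} (hx : MI.mem SC x X)
    (hl : MI.mem SC (Real.log x) LX) (h : thetaInt3 X LX = some Y) :
    MI.mem SC (x ^ 2 / 4 * (Real.log x - Real.log (2 * π)) - 3 * x ^ 2 / 8 - π * x / 8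
      + Real.log x / 48 - 7 / (11520 * x ^ 2)) Y := by
  unfold thetaInt3 at h
  split at h
  · rename_i C hC
    simp only [Option.some.injEq] at h
    subst h
    have hc := MI.mem_divPos SC_pos hC (MI.mem_ofInt SC 7)
      (MI.mem_mulInt (MI.mem_mul SC_pos hx hx) 11520)
    have := MI.mem_sub (mem_thetaInt hx hl) hc
    convert this using 2
    push_cast
    ring
  · exact absurd h (by simp)

/-- `π∫_{2π}^{168π} S ∈ j2PiBox`. [cite: BrentPlattTrudgian2021, §2 eq. (2.9)] -/
private theorem mem_j2PiBox {J : MI} (h : j2PiBox = some J) :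
    MI.mem SC (π * ∫ t in (2 * π)..(168 * π), zetaArgS t) J := by
  have hS := SC_pos
  have hπ := Real.pi_pos
  have herr := abs_pi_mul_integral_zetaArgS_sub_closedForm_le_sharp (b := 2 * π) le_rfl
    (by nlinarith [Real.pi_pos])
  unfold j2PiBox at h
  split at h
  · rename_i LU hLU
    split at h
    · rename_i TU T2 hTU hT2
      simp only [Option.some.injEq] at h
      subst h
      obtain ⟨-, hlogU⟩ := MI.mem_logPos hS hLU mem_uI
      have h1 := MI.mem_mul hS mem_piI (mem_sum mem_twoPiI)
      have h2 := mem_thetaInt3 mem_uI hlogU hTU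
      have h3 := mem_thetaInt3 mem_twoPiI mem_log2PiI hT2
      have h4 := MI.mem_mul hS mem_piI (MI.mem_sub mem_uI mem_twoPiI)
      have hmain := MI.mem_sub (MI.mem_sub h1 (MI.mem_sub h2 h3)) h4
      refine MI.mem_widen hmain ?_
      have hW : (0.000016 : ℝ) * SC ≤ (WJ3 : ℝ) := by
        have hSe : ((SC : ℕ) : ℝ) = 18446744073709551616 := by norm_num [SC]
        have hWe : ((WJ3 : ℤ) : ℝ) = 295147905179353 := by norm_num [WJ3]
        rw [hSe, hWe]; norm_num
      exact le_trans (mul_le_mul_of_nonneg_right herr (by positivity)) hW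
    · exact absurd h (by simp)
  · exact absurd h (by simp)

/-- `πS₁(168π) ∈ piS1UBox`. [cite: Simonic2022, eq. (1.7) (footnote)] -/
private theorem mem_piS1UBox {P : MI} (h : piS1UBox = some P) :
    MI.mem SC (π * ∫ t in (0 : ℝ)..(168 * π), zetaArgS t) P := by
  unfold piS1UBox at h
  split at h
  · rename_i P1 J hP1 hJ
    simp only [Option.some.injEq] at h
    subst h
    have hπ := Real.pi_pos
    have h1 := mem_piS1Box (T := 2 * π) (by positivity) (by linarith [Real.pi_lt_d2]) mem_w2Pi
      mem_twoPiI hP1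
    have h2 := mem_j2PiBox hJ
    have hsplit : ∫ t in (0 : ℝ)..(168 * π), zetaArgS t =
        (∫ t in (0 : ℝ)..(2 * π), zetaArgS t) + ∫ t in (2 * π)..(168 * π), zetaArgS t :=
      (intervalIntegral.integral_add_adjacent_intervals (intervalIntegrable_zetaArgS _ _)
        (intervalIntegrable_zetaArgS _ _)).symm
    rw [hsplit, mul_add]
    exact MI.mem_add h1 h2
  · exact absurd h (by simp)

/-- From `s1UOk`: `|S₁(168π)| ≤ 0.987` and `S₁(168π) ∈ [−0.98663, −0.9866]`.
[cite: Simonic2022, eq. (1.7) (footnote)] -/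
private theorem s1U_sound (h : s1UOk = true) :
    |∫ t in (0 : ℝ)..(168 * π), zetaArgS t| ≤ 0.987 ∧
      -0.98663 ≤ ∫ t in (0 : ℝ)..(168 * π), zetaArgS t ∧
        ∫ t in (0 : ℝ)..(168 * π), zetaArgS t ≤ -0.9866 := by
  have hSr : (0 : ℝ) < SC := by exact_mod_cast SC_pos
  have hπ := Real.pi_pos
  unfold s1UOk at h
  split at h
  · rename_i P hP
    rw [Bool.and_eq_true, Bool.and_eq_true, decide_eq_true_eq, decide_eq_true_eq,
      decide_eq_true_eq] at h
    obtain ⟨ha, hb, hc⟩ := h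
    obtain ⟨hm1, hm2⟩ := mem_piS1UBox hP
    obtain ⟨hp1, hp2⟩ := mem_piI
    set A := ∫ t in (0 : ℝ)..(168 * π), zetaArgS t with hA_def
    have ha' : (max (-(P.lo : ℝ)) (P.hi : ℝ)) * 1000 ≤ 987 * (piI.lo : ℝ) := by
      have := ha; exact_mod_cast this
    have hb' : -(98663 * (piI.lo : ℝ)) ≤ 100000 * (P.lo : ℝ) := by
      have := hb; exact_mod_cast this
    have hc' : 10000 * (P.hi : ℝ) ≤ -(9866 * (piI.hi : ℝ)) := by
      have := hc; exact_mod_cast this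
    have hM1 := le_max_left (-(P.lo : ℝ)) (P.hi : ℝ)
    have hM2 := le_max_right (-(P.lo : ℝ)) (P.hi : ℝ)
    have hQ : 0 < π * (SC : ℝ) := mul_pos hπ hSr
    have e1 : π * A * SC = A * (π * SC) := by ring
    refine ⟨abs_le.2 ⟨?_, ?_⟩, ?_, ?_⟩
    · refine le_of_mul_le_mul_right ?_ hQ
      rw [← e1]; linarith
    · refine le_of_mul_le_mul_right ?_ hQ
      rw [← e1]; linarith
    · refine le_of_mul_le_mul_right ?_ hQ
      rw [← e1]; linarith
    · refine le_of_mul_le_mul_right ?_ hQ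
      rw [← e1]; linarith
  · exact absurd h (by simp)

end S1LowNumerics

/-- **`S₁(168π) ∈ [−0.98663, −0.9866]`** (`S₁(t) = ∫₀ᵗ S`), by the compiled evaluation
`S1LowNumerics.s1Checks_eq_true` of the closed forms (shifted Stirling for `log Γ` on `[0, 2π]`,
the certified first `2000` zeros and third-order Stirling on `[2π, 168π]`). KERNEL STATUS:
computational (`native_decide`). [cite: Simonic2022, eq. (1.7) (footnote: `|S₁(168π)| ≤ 0.987`)] -/
theorem zetaArgS1_168pi_bounds :
    -0.98663 ≤ ∫ t in (0 : ℝ)..(168 * π), zetaArgS t ∧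
      ∫ t in (0 : ℝ)..(168 * π), zetaArgS t ≤ -0.9866 :=
  (S1LowNumerics.s1U_sound S1LowNumerics.s1Checks_eq_true.2).2

/-- **`|S₁(168π)| ≤ 0.987`**, the numerical input of Simonič's (1.7). KERNEL STATUS: computational
(`native_decide`). [cite: Simonic2022, eq. (1.7) (footnote)] -/
theorem abs_zetaArgS1_168pi_le : |∫ t in (0 : ℝ)..(168 * π), zetaArgS t| ≤ 0.987 :=
  (S1LowNumerics.s1U_sound S1LowNumerics.s1Checks_eq_true.2).1

/-- **`|S₁(t)| ≤ 3.054` on `[1, 2π]`** (grid of closed forms, step `1/8`, and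
`|πS| ≤ π + 2.7·6.375` below the first zero). KERNEL STATUS: computational (`native_decide`).
[cite: Simonic2022, eq. (1.7) (footnote: "(1.7) is true for `1 ≤ t ≤ 168π`")] -/
theorem abs_zetaArgS1_le_of_le_two_pi {t : ℝ} (h1 : 1 ≤ t) (h2 : t ≤ 2 * π) :
    |∫ u in (0 : ℝ)..t, zetaArgS u| ≤ 3.054 := by
  have hπ := Real.pi_pos
  have h6 : t ≤ 6.375 := by linarith [Real.pi_lt_d2]
  have h := S1LowNumerics.gridAll_sound S1LowNumerics.s1Checks_eq_true.1 h1 h6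
  rw [abs_mul, abs_of_pos hπ] at h
  nlinarith

/-- **Simonič's unconditional bound (1.7)**: `|S₁(t)| ≤ 0.059 log t + 3.054` for `t ≥ 1`
("This follows from [Trudgian, Improvements to Turing's method II], and the fact that
`|S₁(168π)| ≤ 0.987` and (1.7) is true for `1 ≤ t ≤ 168π`"): for `t ≥ 2π`,
`|S₁(t)| ≤ |S₁(168π)| + |∫_{168π}^t S| ≤ 0.987 + 2.067 + 0.059 log t`
(`BrentPlattTrudgian2021_eq29_holds`); on `[1, 2π]`, `abs_zetaArgS1_le_of_le_two_pi`. KERNEL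
STATUS: computational (`native_decide`). [cite: Simonic2022, eq. (1.7)] -/
theorem abs_zetaArgS1_le {t : ℝ} (ht : 1 ≤ t) :
    |∫ u in (0 : ℝ)..t, zetaArgS u| ≤ 0.059 * Real.log t + 3.054 := by
  have hlog : 0 ≤ Real.log t := Real.log_nonneg ht
  by_cases h2 : t ≤ 2 * π
  · have := abs_zetaArgS1_le_of_le_two_pi ht h2
    linarith
  · have h2' : 2 * π ≤ t := (not_le.1 h2).le
    have hU := abs_zetaArgS1_168pi_le
    have hE := BrentPlattTrudgian2021_eq29_holds t h2'
    have hsplit : ∫ u in (0 : ℝ)..t, zetaArgS u =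
        (∫ u in (0 : ℝ)..(168 * π), zetaArgS u) + ∫ u in (168 * π)..t, zetaArgS u :=
      (intervalIntegral.integral_add_adjacent_intervals (intervalIntegrable_zetaArgS _ _)
        (intervalIntegrable_zetaArgS _ _)).symm
    rw [hsplit]
    calc |(∫ u in (0 : ℝ)..(168 * π), zetaArgS u) + ∫ u in (168 * π)..t, zetaArgS u|
        ≤ |∫ u in (0 : ℝ)..(168 * π), zetaArgS u| + |∫ u in (168 * π)..t, zetaArgS u| :=
          abs_add_le _ _
      _ ≤ 0.987 + (2.067 + 0.059 * Real.log t) := add_le_add hU hE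
      _ = 0.059 * Real.log t + 3.054 := by ring

end Literature.NumberTheory.LFunctions
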